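import Mathlib
import Summits.AtomisticToContinuum.Crystallization.Theses.PhononSlackCertificates
import Summits.AtomisticToContinuum.Crystallization.Theorems.NashClassCertificatesNashNearFieldStubOffFamilyOfNonLayered
import Summits.AtomisticToContinuum.Crystallization.Theorems.PhononSlackCertificatesNearFieldConvexityLayeredThreshold

/-!
# Route `PhononSlackCertificates`, crux `NearFieldConvexity` (stmt-AtomisticToContinuum-13958), line `Sketch`:
the layeredness THRESHOLD of an affinely FLAT site (piece P2 of the stub `stub_perturbativeCoercivity`)

Geometry connecting the layeredness threshold `θ(i) = sInf {e ≥ 0 : the 2-ball of x i is e-layered}` (toolkit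
`…NearFieldConvexityLayeredThreshold`) with affine flatness, in the form the perturbative (Cauchy–Born) regime uses
it.  Suppose the 3-ball of `x i` is two-way `ν`-matched with `x i + G(T_s)`, `T_s = barlowPos 1 (√6/3) s` the unit
ideal Barlow template of a Hägg word `s`, `G` a continuous linear map with the global bi-Lipschitz bounds `4/5`, `6/5`
(the flatness data of the twin crux `NashClassCertificates.NashNearField`).  If moreover `G` is `r`-CLOSE TO THE
FAMILY on the sites of norm `≤ 3` — some linear isometry `A` and box cell `(a, h)` have
`dist (G p₁) (A p_{a,h}) < r` for every unit site `p₁` of norm `≤ 3` — and `max (2ν) (ν + r) < 1/10`, then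

`θ(i) ≤ max (2ν) (ν + r)`.

Proof (`stub_thresholdOfFlat`): for every `η` with `max (2ν) (ν + r) < η ≤ 1/10` the twin's landed geometric stub
`NashClassCertificatesNashNearField.stub_offFamilyOfNonLayered` forbids "not `η`-layered" (it would produce a site with
`dist ≥ η − ν > r`), so the 2-ball is `η`-layered and `θ(i) ≤ η` (`threshold_le_of_layered`); let `η ↓ max (2ν) (ν + r)`.
`[folklore]`.
-/

noncomputable section

open scoped BigOperators
open Literature.MathematicalPhysics.StatisticalMechanics Literature.Geometry.DiscreteGeometry

namespace Summit.AtomisticToContinuum.Crystallization.Theorems.PhononSlackNearFieldConvexity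

/-- **Registered piece `stub_thresholdOfFlat` (P2 of `stub_perturbativeCoercivity`): the layeredness threshold of a
flat site near the family.**  With the flatness data of the twin crux at the particle `i` (3-ball two-way `ν`-matched
with `x i + G(barlowPos 1 (√6/3) s)`, `G` bi-Lipschitz `4/5, 6/5`, `0 ≤ ν`), if some linear isometry `A` and box cell
`(a, h)` satisfy `dist (G p₁) (A (barlowPos a h s m u v)) < r` at every unit site `p₁ = barlowPos 1 (√6/3) s m u v` of
norm `≤ 3`, and `max (2ν) (ν + r) < 1/10`, then `θ(i) ≤ max (2ν) (ν + r)`. [folklore] -/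
theorem stub_thresholdOfFlat : ∀ (N : ℕ) (x : Fin N → EuclideanSpace ℝ (Fin 3)) (i : Fin N) (s : ℤ → ℤ) (G : EuclideanSpace ℝ (Fin 3) →L[ℝ] EuclideanSpace ℝ (Fin 3)) (ν r : ℝ), IsHaggSeq s → 0 ≤ ν → ((∀ j : Fin N, dist (x j) (x i) ≤ 3 → ∃ m u v : ℤ, dist (x j - x i) (G (barlowPos 1 (Real.sqrt 6 / 3) s m u v)) ≤ ν) ∧ (∀ m u v : ℤ, ‖G (barlowPos 1 (Real.sqrt 6 / 3) s m u v)‖ ≤ 3 → ∃ j : Fin N, dist (x j - x i) (G (barlowPos 1 (Real.sqrt 6 / 3) s m u v)) ≤ ν) ∧ (∀ p : EuclideanSpace ℝ (Fin 3), 4 / 5 * ‖p‖ ≤ ‖G p‖ ∧ ‖G p‖ ≤ 6 / 5 * ‖p‖)) → ∀ (A : EuclideanSpace ℝ (Fin 3) →ₗᵢ[ℝ] EuclideanSpace ℝ (Fin 3)) (a h : ℝ), 47 / 50 ≤ a → a ≤ 1 → 39 / 50 * a ≤ h → h ≤ 17 / 20 * a → (∀ m u v : ℤ, ‖barlowPos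 1 (Real.sqrt 6 / 3) s m u v‖ ≤ 3 → dist (G (barlowPos 1 (Real.sqrt 6 / 3) s m u v)) (A (barlowPos a h s m u v)) < r) → max (2 * ν) (ν + r) < 1 / 10 → sInf {e : ℝ | 0 ≤ e ∧ (∃ (A : EuclideanSpace ℝ (Fin 3) →ₗᵢ[ℝ] EuclideanSpace ℝ (Fin 3)) (t : EuclideanSpace ℝ (Fin 3)) (a : ℝ) (s : ℤ → ℤ) (z : ℤ → ℝ), 47 / 50 ≤ a ∧ a ≤ 1 ∧ IsHaggSeq s ∧ (∀ m : ℤ, 39 / 50 * a ≤ z (m + 1) - z m ∧ z (m + 1) - z m ≤ 17 / 20 * a) ∧ (fun S : Set (EuclideanSpace ℝ (Fin 3)) => (∀ j : Fin N, dist (x j) (x i) ≤ 2 → ∃ p ∈ S, dist (x j + t) p ≤ e) ∧ (∀ p ∈ S, dist p (x i + t) ≤ 2 → ∃ j : Fin N, dist (x j + t) p ≤ e)) {p | ∃ m i j : ℤ, p = A (((i : ℝ) • triangularVec₁ a) + ((j : ℝ) • triangularVec₂ a) + ((haggLabel s m : ℝ) • barlowOffset a) + (z m • layerNormal 1))})}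 ≤ max (2 * ν) (ν + r) := by
  intro N x i s G ν r hs hν hflat A a h ha₁ ha₂ hh₁ hh₂ hclose hM
  refine le_of_forall_gt_imp_ge_of_dense fun η' hη' => ?_
  -- shrink the tolerance below `1/10`: `η = min η' (1/10)`
  set η : ℝ := min η' (1 / 10) with hηdef
  have hMη : max (2 * ν) (ν + r) < η := lt_min hη' hM
  have hη10 : η ≤ 1 / 10 := min_le_right _ _
  have hηle : η ≤ η' := min_le_left _ _
  have h2ν : 2 * ν < η := lt_of_le_of_lt (le_max_left _ _) hMη
  have hνr : ν + r < η := lt_of_le_of_lt (le_max_right _ _) hMη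
  have hη0 : 0 ≤ η := by linarith
  refine le_trans (threshold_le_of_layered x i hη0 ?_) hηle
  -- the 2-ball is `η`-layered: otherwise the twin's stub produces an `(η − ν)`-far site, contradicting `hclose`
  by_contra hNL
  obtain ⟨m, u, v, hn, hfar⟩ :=
    Summit.AtomisticToContinuum.Crystallization.Theorems.NashClassCertificatesNashNearField.stub_offFamilyOfNonLayered
      N x i s G ν η hs hν (by linarith) hη10 hflat hNL A a h ha₁ ha₂ hh₁ hh₂
  have hlt := hclose m u v hn
  linarith

/-- **Curried corollary: flat sites near the family are `η`-layered** for every `η` with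
`max (2ν) (ν + r) < η` (combine `stub_thresholdOfFlat` with `layered_of_threshold_lt`). [folklore] -/
theorem layered_of_flat {N : ℕ} (x : Fin N → EuclideanSpace ℝ (Fin 3)) (i : Fin N) {s : ℤ → ℤ}
    {G : EuclideanSpace ℝ (Fin 3) →L[ℝ] EuclideanSpace ℝ (Fin 3)} {ν r η : ℝ} (hs : IsHaggSeq s) (hν : 0 ≤ ν)
    (hflat : ((∀ j : Fin N, dist (x j) (x i) ≤ 3 → ∃ m u v : ℤ, dist (x j - x i) (G (barlowPos 1 (Real.sqrt 6 / 3) s m u v)) ≤ ν) ∧ (∀ m u v : ℤ, ‖G (barlowPos 1 (Real.sqrt 6 / 3) s m u v)‖ ≤ 3 → ∃ j : Fin N, dist (x j - x i) (G (barlowPos 1 (Real.sqrt 6 / 3) s m u v)) ≤ ν) ∧ (∀ p : EuclideanSpace ℝ (Fin 3), 4 / 5 * ‖p‖ ≤ ‖G p‖ ∧ ‖G p‖ ≤ 6 / 5 * ‖p‖)))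
    (A : EuclideanSpace ℝ (Fin 3) →ₗᵢ[ℝ] EuclideanSpace ℝ (Fin 3)) {a h : ℝ} (ha₁ : 47 / 50 ≤ a) (ha₂ : a ≤ 1)
    (hh₁ : 39 / 50 * a ≤ h) (hh₂ : h ≤ 17 / 20 * a)
    (hclose : ∀ m u v : ℤ, ‖barlowPos 1 (Real.sqrt 6 / 3) s m u v‖ ≤ 3 →
      dist (G (barlowPos 1 (Real.sqrt 6 / 3) s m u v)) (A (barlowPos a h s m u v)) < r)
    (hM : max (2 * ν) (ν + r) < 1 / 10) (hη : max (2 * ν) (ν + r) < η) :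
    (∃ (A : EuclideanSpace ℝ (Fin 3) →ₗᵢ[ℝ] EuclideanSpace ℝ (Fin 3)) (t : EuclideanSpace ℝ (Fin 3)) (a : ℝ) (s : ℤ → ℤ) (z : ℤ → ℝ), 47 / 50 ≤ a ∧ a ≤ 1 ∧ IsHaggSeq s ∧ (∀ m : ℤ, 39 / 50 * a ≤ z (m + 1) - z m ∧ z (m + 1) - z m ≤ 17 / 20 * a) ∧ (fun S : Set (EuclideanSpace ℝ (Fin 3)) => (∀ j : Fin N, dist (x j) (x i) ≤ 2 → ∃ p ∈ S, dist (x j + t) p ≤ η) ∧ (∀ p ∈ S, dist p (x i + t) ≤ 2 → ∃ j : Fin N, dist (x j + t) p ≤ η)) {p | ∃ m i j : ℤ, p = A (((i : ℝ) • triangularVec₁ a) + ((j : ℝ) • triangularVec₂ a) + ((haggLabel s m : ℝ) • barlowOffset a) + (z m • layerNormal 1))}) :=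
  layered_of_threshold_lt x i
    (lt_of_le_of_lt (stub_thresholdOfFlat N x i s G ν r hs hν hflat A a h ha₁ ha₂ hh₁ hh₂ hclose hM) hη)


/-- **Unconditional linear form**: with the flatness data and `r`-closeness to the family as in
`stub_thresholdOfFlat` but WITHOUT the smallness hypothesis, `θ(i) ≤ 20 · max (2ν) (ν + r)` (if the max is `≥ 1/10`
use `θ(i) ≤ 2`, `threshold_le_two`). [folklore] -/
theorem threshold_le_twenty_mul_of_flat {N : ℕ} (x : Fin N → EuclideanSpace ℝ (Fin 3)) (i : Fin N) {s : ℤ → ℤ}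
    {G : EuclideanSpace ℝ (Fin 3) →L[ℝ] EuclideanSpace ℝ (Fin 3)} {ν r : ℝ} (hs : IsHaggSeq s) (hν : 0 ≤ ν)
    (hflat : ((∀ j : Fin N, dist (x j) (x i) ≤ 3 → ∃ m u v : ℤ, dist (x j - x i) (G (barlowPos 1 (Real.sqrt 6 / 3) s m u v)) ≤ ν) ∧ (∀ m u v : ℤ, ‖G (barlowPos 1 (Real.sqrt 6 / 3) s m u v)‖ ≤ 3 → ∃ j : Fin N, dist (x j - x i) (G (barlowPos 1 (Real.sqrt 6 / 3) s m u v)) ≤ ν) ∧ (∀ p : EuclideanSpace ℝ (Fin 3), 4 / 5 * ‖p‖ ≤ ‖G p‖ ∧ ‖G p‖ ≤ 6 / 5 * ‖p‖)))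
    (A : EuclideanSpace ℝ (Fin 3) →ₗᵢ[ℝ] EuclideanSpace ℝ (Fin 3)) {a h : ℝ} (ha₁ : 47 / 50 ≤ a) (ha₂ : a ≤ 1)
    (hh₁ : 39 / 50 * a ≤ h) (hh₂ : h ≤ 17 / 20 * a)
    (hclose : ∀ m u v : ℤ, ‖barlowPos 1 (Real.sqrt 6 / 3) s m u v‖ ≤ 3 →
      dist (G (barlowPos 1 (Real.sqrt 6 / 3) s m u v)) (A (barlowPos a h s m u v)) < r) :
    sInf {e : ℝ | 0 ≤ e ∧ (∃ (A : EuclideanSpace ℝ (Fin 3) →ₗᵢ[ℝ] EuclideanSpace ℝ (Fin 3)) (t : EuclideanSpace ℝ (Fin 3)) (a : ℝ) (s : ℤ → ℤ) (z : ℤ → ℝ), 47 / 50 ≤ a ∧ a ≤ 1 ∧ IsHaggSeq s ∧ (∀ m : ℤ, 39 / 50 * a ≤ z (m + 1) - z m ∧ z (m + 1) - z m ≤ 17 / 20 * a) ∧ (fun S : Set (EuclideanSpace ℝ (Fin 3)) => (∀ j : Fin N, dist (x j) (x i) ≤ 2 → ∃ p ∈ S, dist (x j + t) p ≤ e) ∧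 (∀ p ∈ S, dist p (x i + t) ≤ 2 → ∃ j : Fin N, dist (x j + t) p ≤ e)) {p | ∃ m i j : ℤ, p = A (((i : ℝ) • triangularVec₁ a) + ((j : ℝ) • triangularVec₂ a) + ((haggLabel s m : ℝ) • barlowOffset a) + (z m • layerNormal 1))})} ≤ 20 * max (2 * ν) (ν + r) := by
  by_cases hM : max (2 * ν) (ν + r) < 1 / 10
  · have hθ := stub_thresholdOfFlat N x i s G ν r hs hν hflat A a h ha₁ ha₂ hh₁ hh₂ hclose hM
    have h0 : 0 ≤ max (2 * ν) (ν + r) := le_trans (by linarith) (le_max_left _ _)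
    linarith
  · push Not at hM
    have h2 := threshold_le_two x i
    linarith

/-- **Squared form for the Chebyshev step**: under the same data, `θ(i)² ≤ 2400 ν² + 800 r²`
(`θ ≤ 20 max (2ν) (ν + r)`, `θ ≥ 0`, and `max² ≤ (2ν)² ∨ (ν + r)² ≤ 6ν² + 2r²`). [folklore] -/
theorem threshold_sq_le_of_flat {N : ℕ} (x : Fin N → EuclideanSpace ℝ (Fin 3)) (i : Fin N) {s : ℤ → ℤ}
    {G : EuclideanSpace ℝ (Fin 3) →L[ℝ] EuclideanSpace ℝ (Fin 3)} {ν r : ℝ} (hs : IsHaggSeq s) (hν : 0 ≤ ν)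
    (hflat : ((∀ j : Fin N, dist (x j) (x i) ≤ 3 → ∃ m u v : ℤ, dist (x j - x i) (G (barlowPos 1 (Real.sqrt 6 / 3) s m u v)) ≤ ν) ∧ (∀ m u v : ℤ, ‖G (barlowPos 1 (Real.sqrt 6 / 3) s m u v)‖ ≤ 3 → ∃ j : Fin N, dist (x j - x i) (G (barlowPos 1 (Real.sqrt 6 / 3) s m u v)) ≤ ν) ∧ (∀ p : EuclideanSpace ℝ (Fin 3), 4 / 5 * ‖p‖ ≤ ‖G p‖ ∧ ‖G p‖ ≤ 6 / 5 * ‖p‖)))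
    (A : EuclideanSpace ℝ (Fin 3) →ₗᵢ[ℝ] EuclideanSpace ℝ (Fin 3)) {a h : ℝ} (ha₁ : 47 / 50 ≤ a) (ha₂ : a ≤ 1)
    (hh₁ : 39 / 50 * a ≤ h) (hh₂ : h ≤ 17 / 20 * a)
    (hclose : ∀ m u v : ℤ, ‖barlowPos 1 (Real.sqrt 6 / 3) s m u v‖ ≤ 3 →
      dist (G (barlowPos 1 (Real.sqrt 6 / 3) s m u v)) (A (barlowPos a h s m u v)) < r) :
    sInf {e : ℝ | 0 ≤ e ∧ (∃ (A : EuclideanSpace ℝ (Fin 3) →ₗᵢ[ℝ] EuclideanSpace ℝ (Fin 3)) (t : EuclideanSpace ℝ (Fin 3)) (a : ℝ) (s : ℤ → ℤ) (z : ℤ → ℝ), 47 / 50 ≤ a ∧ a ≤ 1 ∧ IsHaggSeq s ∧ (∀ m : ℤ, 39 / 50 * a ≤ z (m + 1) - z m ∧ z (m + 1) - z m ≤ 17 / 20 * a) ∧ (fun S : Set (EuclideanSpace ℝ (Fin 3)) => (∀ j : Fin N, dist (x j) (x i) ≤ 2 → ∃ p ∈ S, dist (x j + t) p ≤ e) ∧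 (∀ p ∈ S, dist p (x i + t) ≤ 2 → ∃ j : Fin N, dist (x j + t) p ≤ e)) {p | ∃ m i j : ℤ, p = A (((i : ℝ) • triangularVec₁ a) + ((j : ℝ) • triangularVec₂ a) + ((haggLabel s m : ℝ) • barlowOffset a) + (z m • layerNormal 1))})} ^ 2 ≤ 2400 * ν ^ 2 + 800 * r ^ 2 := by
  have hθ := threshold_le_twenty_mul_of_flat x i hs hν hflat A ha₁ ha₂ hh₁ hh₂ hclose
  have h0 := threshold_nonneg x i
  have hsq := mul_self_le_mul_self h0 hθ
  rcases le_total (2 * ν) (ν + r) with hle | hle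
  · rw [max_eq_right hle] at hsq
    nlinarith [sq_nonneg (ν - r), sq_nonneg ν]
  · rw [max_eq_left hle] at hsq
    nlinarith [sq_nonneg r, sq_nonneg ν]

end Summit.AtomisticToContinuum.Crystallization.Theorems.PhononSlackNearFieldConvexity
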